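import Summits.BirchSwinnertonDyer.BirchSwinnertonDyer.Theorems.KolyvaginRoadThreeMethod2TriangulationOfLocalGlobal
import Summits.BirchSwinnertonDyer.BirchSwinnertonDyer.Theorems.KolyvaginRoadThreeMethod2Iso
import HarnessLib

/-!
# KOLY method line, crux stmt-BirchSwinnertonDyer-19574 `ZhangSharpFrameAtThreeHL`, stub S2-ENGINE: Zhang's Lemma 8.4
# triangulation at one good level from the KOLYVAGIN-PRIME LOCAL PACKAGE + (Supply) ONLY — the local Tate pairing, (REC),
# the Kummer isotropy and the ordinary isotropy above good unipotent-admissible primes DISCHARGED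
# (cell `bsd-stepL`, seat `bsd-stepL-zhang3-p1` g9; `--supports 19574`, helper)

HONEST FRAMING. One theorem; 0 definitions, 0 named facts, 0 `sorry`; CONDITIONAL on the Kolyvagin-prime local package
((Tr-iso), (Perf), (Line)) and on (Supply) at the level; closes nothing (T7). PARTITION: O2@3 (B10) × A1 × crux 19574 ×
stub S2-ENGINE — types-the-object-of.

WHAT. `Method2.triangulation_of_kolyvaginLocal`: the conclusion of `Method2.triangulation_of_localGlobal` (this seat,
p505196: the (A3) shape of the engine for `SelQ n` ∕ `SelRelQ n (baseLocusQ S.κ n)` at ONE good non-empty level `n`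
carrying a non-zero class — the body of koly g14's binder `hT`) with the LEVEL-SYSTEM-FREE, KOLYVAGIN-PRIME-FREE part of
the local–global package SUPPLIED IN THE KERNEL:
* the localisations `loc_v := galoisCohomology.localization` as `ZMod 3`-linear maps (`AddMonoidHom.toZModLinearMap`);
* the places `λ = (ℓ)`, `v_q = (q)` of the (inert) Kolyvagin ∕ unipotent-admissible primes (ANY choice `plK`, `plU`);
* the bilinear local forms `b_v := inv_v ∘ (· ∪ₑ ·)` — `e` a Weil pairing on `E[3]` (`exists_weilPairing_holds`),
  `∪ₑ` the local Weil cup product (`weilContPairingLocal`), `inv` the Poitou–Tate family of the totally complex `K`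
  (tree THEOREM `poitouTate_sum_localTatePairing_eq_zero_of_isTotallyComplex`: `IsPerfect ∧ SumLocalTermEqZero`);
* (REC) `∑_{v ∈ T} b_v(loc_v x, loc_v y) = 0` ⟸ `sum_inv_weilCupProduct_localization_eq_zero` (Milne I Thm 4.10);
* Kummer isotropy at every place ⟸ `cupProduct_eq_zero_of_mem_kummerLocalConditionAt_of_fact` with the DISCHARGED
  Poonen–Rains fact `kummerClass_cupProduct_kummerClass_eq_zero_holds`;
* ordinary isotropy ABOVE GOOD unipotent-admissible primes ⟸ koly g13 `Iso.weilCupProduct_res_eq_zero_of_mem_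
  ordinaryLocalKer` + `weilPairingHom_eq_zero_of_invariant_of_card_le` + `natCard_invariants_le_three_of_frobSqNeOneAt`
  (`h⁰(K_v, E[3]) = 1` there; at places with trivial Frobenius on `E[3]` the ordinary condition is NOT isotropic, which
  is why the level-wise form p505196 is the honest currency).
What REMAINS as hypotheses, all LOCAL AT KOLYVAGIN PRIMES `λ` or (Supply): (Tr-iso) `hisoTr` — the transverse
condition (`Method2.transverseLocalKer`, Zhang §8.1 `H¹_tr`) is isotropic for the local Weil cup product; (Perf) `hperf`
— the cup product of a non-zero Kummer eigen-class and a non-zero transverse eigen-class of the same sign is non-zero;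
(Line) `hline` — the Kummer eigen-line; (Supply) `hSupply` — Zhang's Lemma 8.2 for the level-`n` structure (koly3b).
(Tr-iso) and (Perf) are asked for EVERY Weil-type pairing `e` on `E[3]`, in cup-product currency (`inv_λ` is injective).
References: [cite: WZhang2014, §8.1, Lemma 8.2, Lemma 8.4] [cite: MilneADT2006, Ch. I, Cor. 2.3, Thm. 4.10]
[cite: PoonenRains2012, Prop. 4.8, Cor. 4.6] [cite: CasselsFrohlichANT1967, Ch. VII §11].
-/

noncomputable section

open scoped Classical

namespace Summit.BirchSwinnertonDyer.Rank1Residual.X11b.Three.Koly.Method2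

open CategoryTheory WeierstrassCurve NumberField IsDedekindDomain Field
  Literature.NumberTheory.EllipticCurves Literature.NumberTheory.EllipticCurves.ModularForms
  Literature.NumberTheory.GaloisRepresentations Module
open Literature.NumberTheory.GaloisRepresentations.DiscreteGaloisModule (mu MuCarrier)
open Literature.NumberTheory.GaloisCohomology
open scoped ContRepresentation

-- Cup products need `LocallyCompactSpace Γ`; as in the tree's cup-product files, the compactness of
-- absolute Galois groups is a local instance only; `E[n]` finite for the Tate-dual bookkeeping.
attribute [local instance] absoluteGaloisGroup_compactSpace
attribute [local instance] finite_geomTorsion_of_neZero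

variable (W : WeierstrassCurve ℚ) (K : Type) [Field K] [NumberField K]
variable [W.IsElliptic] [W.IsGloballyMinimal] [NeZero (W.conductorNorm ℤ)]
  (Dt : ModularParametrizationData W (W.conductorNorm ℤ)) (β : ℤ) (ι : K →+* ℂ) (c : K ≃ₐ[ℚ] K)
  [Module (ZMod 3) (V3 W K)]


/-! ## §1 The package lemmas (one declaration each, to keep every elaboration within the default heartbeat budget) -/

section Package

omit [W.IsGloballyMinimal] [NeZero (W.conductorNorm ℤ)] [Module (ZMod 3) (V3 W K)] in
/-- A `ZMod 3`-multiple is the corresponding natural multiple (any `ZMod 3`-module structure). [folklore] -/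
private theorem zmod_smul_eq_val_nsmul {M : Type*} [AddCommGroup M] [Module (ZMod 3) M] (a : ZMod 3) (x : M) :
    a • x = a.val • x := by
  conv_lhs => rw [← ZMod.natCast_zmod_val a]
  rw [Nat.cast_smul_eq_nsmul]

variable [∀ v : Place K, Module (ZMod 3) (galoisCohomology (((W.baseChange K).torsionGaloisModule ((3 ^ 1 : ℕ) :
    ℤ)).toLocal v) 1)]

omit [W.IsElliptic] [W.IsGloballyMinimal] [NeZero (W.conductorNorm ℤ)] in
/-- **The genuine localisations as `ZMod 3`-linear maps** (`AddMonoidHom.toZModLinearMap` of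
`galoisCohomology.localization`; any `ZMod 3`-structures). [folklore] -/
theorem exists_zmodLinear_localization :
    ∃ loc : (v : Place K) → V3 W K →ₗ[ZMod 3] galoisCohomology (((W.baseChange K).torsionGaloisModule ((3 ^ 1 : ℕ)
        : ℤ)).toLocal v) 1,
      ∀ (v : Place K) (x : V3 W K), loc v x = galoisCohomology.localization ((W.baseChange K).torsionGaloisModule
          ((3 ^ 1 : ℕ) : ℤ)) v 1 x :=
  ⟨fun v ↦ (show V3 W K →+ galoisCohomology (((W.baseChange K).torsionGaloisModule ((3 ^ 1 : ℕ) : ℤ)).toLocal v) 1 from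
      galoisCohomology.localization ((W.baseChange K).torsionGaloisModule ((3 ^ 1 : ℕ) : ℤ)) v 1).toZModLinearMap
          3, fun _ _ ↦ rfl⟩

variable (e : geomTorsion (W.baseChange K) ((3 ^ 1 : ℕ) : ℤ) → geomTorsion (W.baseChange K) ((3 ^ 1 : ℕ) : ℤ) →
    AlgebraicClosure K)
  (hμ : ∀ P Q, e P Q ^ (3 ^ 1) = 1) (hadd₁ : ∀ P₁ P₂ Q, e (P₁ + P₂) Q = e P₁ Q * e P₂ Q)
  (hadd₂ : ∀ P Q₁ Q₂, e P (Q₁ + Q₂) = e P Q₁ * e P Q₂)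
  (hgal : ∀ (σ : absoluteGaloisGroup K) (P Q : geomTorsion (W.baseChange K) ((3 ^ 1 : ℕ) : ℤ)),
    σ • e P Q = e (σ • P) (σ • Q))
  (inv : LocalInvariants K (3 ^ 1))

omit [W.IsElliptic] [W.IsGloballyMinimal] [NeZero (W.conductorNorm ℤ)] [Module (ZMod 3) (V3 W K)] in
/-- **The local forms `b_v = inv_v ∘ (· ∪ₑ ·)` as `ZMod 3`-bilinear maps** on `H¹(K_v, E[3])` (bi-additivity of the cup
product and of `inv_v`; any `ZMod 3`-structures). [cite: MilneADT2006, Ch. I §2 (cup product pairing)] -/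
theorem exists_zmodBilinear_invCupProduct :
    ∃ b : (v : Place K) →
      galoisCohomology (((W.baseChange K).torsionGaloisModule ((3 ^ 1 : ℕ) : ℤ)).toLocal v) 1 →ₗ[ZMod 3]
          galoisCohomology (((W.baseChange K).torsionGaloisModule ((3 ^ 1 : ℕ) : ℤ)).toLocal v) 1 →ₗ[ZMod 3] ZMod 3,
      ∀ (v : Place K) x y,
        b v x y = inv v ((weilContPairingLocal (W.baseChange K) (3 ^ 1) e hμ hadd₁ hadd₂ hgal v).cupProduct x y) := by
  -- bi-additivity of `(x, y) ↦ inv_v (x ∪ₑ y)` in the syntactic currency of `galoisCohomology` (defeq bookkeeping)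
  have hadd_left : ∀ (v : Place K) (x x' y : galoisCohomology (((W.baseChange K).torsionGaloisModule ((3 ^ 1 : ℕ) :
      ℤ)).toLocal v) 1),
      (weilContPairingLocal (W.baseChange K) (3 ^ 1) e hμ hadd₁ hadd₂ hgal v).cupProduct (x + x' : galoisCohomology
          (((W.baseChange K).torsionGaloisModule ((3 ^ 1 : ℕ) : ℤ)).toLocal v) 1) y =
        (weilContPairingLocal (W.baseChange K) (3 ^ 1) e hμ hadd₁ hadd₂ hgal v).cupProduct x y +
            (weilContPairingLocal (W.baseChange K) (3 ^ 1) e hμ hadd₁ hadd₂ hgal v).cupProduct x' y :=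
    fun v x x' y ↦ (congrArg (fun f ↦ f y) (map_add (weilContPairingLocal (W.baseChange K) (3 ^ 1) e hμ hadd₁ hadd₂
        hgal v).cupProduct x x')).trans (LinearMap.add_apply _ _ _)
  have hadd_right : ∀ (v : Place K) (x y y' : galoisCohomology (((W.baseChange K).torsionGaloisModule ((3 ^ 1 : ℕ)
      : ℤ)).toLocal v) 1),
      (weilContPairingLocal (W.baseChange K) (3 ^ 1) e hμ hadd₁ hadd₂ hgal v).cupProduct x (y + y' :
          galoisCohomology (((W.baseChange K).torsionGaloisModule ((3 ^ 1 : ℕ) : ℤ)).toLocal v) 1) =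
        (weilContPairingLocal (W.baseChange K) (3 ^ 1) e hμ hadd₁ hadd₂ hgal v).cupProduct x y +
            (weilContPairingLocal (W.baseChange K) (3 ^ 1) e hμ hadd₁ hadd₂ hgal v).cupProduct x y' :=
    fun v x y y' ↦ map_add ((weilContPairingLocal (W.baseChange K) (3 ^ 1) e hμ hadd₁ hadd₂ hgal v).cupProduct x) y y'
  have hnsmul_left : ∀ (v : Place K) (k : ℕ) (x y : galoisCohomology (((W.baseChange K).torsionGaloisModule ((3 ^ 1
      : ℕ) : ℤ)).toLocal v) 1),
      (weilContPairingLocal (W.baseChange K) (3 ^ 1) e hμ hadd₁ hadd₂ hgal v).cupProduct (k • x : galoisCohomology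
          (((W.baseChange K).torsionGaloisModule ((3 ^ 1 : ℕ) : ℤ)).toLocal v) 1) y = k • (weilContPairingLocal
          (W.baseChange K) (3 ^ 1) e hμ hadd₁ hadd₂ hgal v).cupProduct x y := fun v k x y ↦ by
    induction k with
    | zero =>
      rw [zero_nsmul, zero_nsmul]
      have h := hadd_left v 0 0 y
      rw [add_zero] at h
      exact add_left_cancel (h.symm.trans (add_zero _).symm)
    | succ k ih => rw [succ_nsmul, succ_nsmul, hadd_left, ih]
  have hnsmul_right : ∀ (v : Place K) (k : ℕ) (x y : galoisCohomology (((W.baseChange K).torsionGaloisModule ((3 ^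
      1 : ℕ) : ℤ)).toLocal v) 1),
      (weilContPairingLocal (W.baseChange K) (3 ^ 1) e hμ hadd₁ hadd₂ hgal v).cupProduct x (k • y :
          galoisCohomology (((W.baseChange K).torsionGaloisModule ((3 ^ 1 : ℕ) : ℤ)).toLocal v) 1) = k •
          (weilContPairingLocal (W.baseChange K) (3 ^ 1) e hμ hadd₁ hadd₂ hgal v).cupProduct x y := fun v k x y ↦ by
    induction k with
    | zero =>
      rw [zero_nsmul, zero_nsmul]
      have h := hadd_right v x 0 0
      rw [add_zero] at h
      exact add_left_cancel (h.symm.trans (add_zero _).symm)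
    | succ k ih => rw [succ_nsmul, succ_nsmul, hadd_right, ih]
  have hinv_add_left : ∀ (v : Place K) (x x' y : galoisCohomology (((W.baseChange K).torsionGaloisModule ((3 ^ 1 :
      ℕ) : ℤ)).toLocal v) 1),
      inv v ((weilContPairingLocal (W.baseChange K) (3 ^ 1) e hμ hadd₁ hadd₂ hgal v).cupProduct x y +
          (weilContPairingLocal (W.baseChange K) (3 ^ 1) e hμ hadd₁ hadd₂ hgal v).cupProduct x' y) = inv v
          ((weilContPairingLocal (W.baseChange K) (3 ^ 1) e hμ hadd₁ hadd₂ hgal v).cupProduct x y) + inv v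
          ((weilContPairingLocal (W.baseChange K) (3 ^ 1) e hμ hadd₁ hadd₂ hgal v).cupProduct x' y) :=
    fun v x x' y ↦ map_add _ _ _
  have hinv_add_right : ∀ (v : Place K) (x y y' : galoisCohomology (((W.baseChange K).torsionGaloisModule ((3 ^ 1 :
      ℕ) : ℤ)).toLocal v) 1),
      inv v ((weilContPairingLocal (W.baseChange K) (3 ^ 1) e hμ hadd₁ hadd₂ hgal v).cupProduct x y +
          (weilContPairingLocal (W.baseChange K) (3 ^ 1) e hμ hadd₁ hadd₂ hgal v).cupProduct x y') = inv v
          ((weilContPairingLocal (W.baseChange K) (3 ^ 1) e hμ hadd₁ hadd₂ hgal v).cupProduct x y) + inv v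
          ((weilContPairingLocal (W.baseChange K) (3 ^ 1) e hμ hadd₁ hadd₂ hgal v).cupProduct x y') :=
    fun v x y y' ↦ map_add _ _ _
  have hinv_nsmul : ∀ (v : Place K) (k : ℕ) (x y : galoisCohomology (((W.baseChange K).torsionGaloisModule ((3 ^ 1
      : ℕ) : ℤ)).toLocal v) 1),
      (inv v (k • (weilContPairingLocal (W.baseChange K) (3 ^ 1) e hμ hadd₁ hadd₂ hgal v).cupProduct x y) : ZMod 3)
          = k • (inv v ((weilContPairingLocal (W.baseChange K) (3 ^ 1) e hμ hadd₁ hadd₂ hgal v).cupProduct x y) :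
          ZMod 3) :=
    fun v k x y ↦ map_nsmul _ _ _
  have hzmodF : ∀ (a t : ZMod 3), a • t = a.val • t := fun a t ↦ zmod_smul_eq_val_nsmul a t
  refine ⟨fun v ↦ LinearMap.mk₂ (ZMod 3) (fun (x y : galoisCohomology (((W.baseChange K).torsionGaloisModule ((3 ^
      1 : ℕ) : ℤ)).toLocal v) 1) ↦ (inv v ((weilContPairingLocal (W.baseChange K) (3 ^ 1) e hμ hadd₁ hadd₂ hgal
      v).cupProduct x y) : ZMod 3))
      (fun x x' y ↦ by
        show inv v ((weilContPairingLocal (W.baseChange K) (3 ^ 1) e hμ hadd₁ hadd₂ hgal v).cupProduct (x + x' :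
            galoisCohomology (((W.baseChange K).torsionGaloisModule ((3 ^ 1 : ℕ) : ℤ)).toLocal v) 1) y) = inv v
            ((weilContPairingLocal (W.baseChange K) (3 ^ 1) e hμ hadd₁ hadd₂ hgal v).cupProduct x y) + inv v
            ((weilContPairingLocal (W.baseChange K) (3 ^ 1) e hμ hadd₁ hadd₂ hgal v).cupProduct x' y)
        rw [hadd_left, hinv_add_left])
      (fun a x y ↦ by
        show inv v ((weilContPairingLocal (W.baseChange K) (3 ^ 1) e hμ hadd₁ hadd₂ hgal v).cupProduct (a • x :
            galoisCohomology (((W.baseChange K).torsionGaloisModule ((3 ^ 1 : ℕ) : ℤ)).toLocal v) 1) y) = a • inv v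
            ((weilContPairingLocal (W.baseChange K) (3 ^ 1) e hμ hadd₁ hadd₂ hgal v).cupProduct x y)
        rw [zmod_smul_eq_val_nsmul a x, hnsmul_left, hinv_nsmul, hzmodF])
      (fun x y y' ↦ by
        show inv v ((weilContPairingLocal (W.baseChange K) (3 ^ 1) e hμ hadd₁ hadd₂ hgal v).cupProduct x (y + y' :
            galoisCohomology (((W.baseChange K).torsionGaloisModule ((3 ^ 1 : ℕ) : ℤ)).toLocal v) 1)) = inv v
            ((weilContPairingLocal (W.baseChange K) (3 ^ 1) e hμ hadd₁ hadd₂ hgal v).cupProduct x y) + inv v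
            ((weilContPairingLocal (W.baseChange K) (3 ^ 1) e hμ hadd₁ hadd₂ hgal v).cupProduct x y')
        rw [hadd_right, hinv_add_right])
      (fun a x y ↦ by
        show inv v ((weilContPairingLocal (W.baseChange K) (3 ^ 1) e hμ hadd₁ hadd₂ hgal v).cupProduct x (a • y :
            galoisCohomology (((W.baseChange K).torsionGaloisModule ((3 ^ 1 : ℕ) : ℤ)).toLocal v) 1)) = a • inv v
            ((weilContPairingLocal (W.baseChange K) (3 ^ 1) e hμ hadd₁ hadd₂ hgal v).cupProduct x y)
        rw [zmod_smul_eq_val_nsmul a y, hnsmul_right, hinv_nsmul, hzmodF]), fun _ _ _ ↦ rfl⟩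

variable {e hμ hadd₁ hadd₂ hgal inv}
  {b : (v : Place K) →
    galoisCohomology (((W.baseChange K).torsionGaloisModule ((3 ^ 1 : ℕ) : ℤ)).toLocal v) 1 →ₗ[ZMod 3]
        galoisCohomology (((W.baseChange K).torsionGaloisModule ((3 ^ 1 : ℕ) : ℤ)).toLocal v) 1 →ₗ[ZMod 3] ZMod 3}
  (hb : ∀ (v : Place K) x y,
    b v x y = inv v ((weilContPairingLocal (W.baseChange K) (3 ^ 1) e hμ hadd₁ hadd₂ hgal v).cupProduct x y))
  {loc : (v : Place K) → V3 W K →ₗ[ZMod 3] galoisCohomology (((W.baseChange K).torsionGaloisModule ((3 ^ 1 : ℕ) :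
      ℤ)).toLocal v) 1}
  (hloc : ∀ (v : Place K) (x : V3 W K), loc v x = galoisCohomology.localization ((W.baseChange
      K).torsionGaloisModule ((3 ^ 1 : ℕ) : ℤ)) v 1 x)

omit [W.IsGloballyMinimal] [NeZero (W.conductorNorm ℤ)] in
include hb hloc in
/-- **(REC) for `b_v = inv_v ∘ ∪ₑ`**: Tate's reciprocity law for the Weil cup product on `E[3]` over the totally complex
`K` (`sum_inv_weilCupProduct_localization_eq_zero`). [cite: MilneADT2006, Ch. I, Thm. 4.10]
[cite: CasselsFrohlichANT1967, Ch. VII §11] -/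
theorem sum_invCupProduct_eq_zero (hPT : inv.SumLocalTermEqZero) (x y : V3 W K) (T : Finset (Place K))
    (hT : ∀ v, v ∉ T → b v (loc v x) (loc v y) = 0) : ∑ v ∈ T, b v (loc v x) (loc v y) = 0 := by
  have h := sum_inv_weilCupProduct_localization_eq_zero (W.baseChange K) (3 ^ 1) e hμ hadd₁ hadd₂ hgal inv hPT
    x y T (fun v hv ↦ by have h' := hT v hv; rw [hb, hloc, hloc] at h'; exact h')
  simp only [hb, hloc]
  exact h

omit [W.IsGloballyMinimal] [NeZero (W.conductorNorm ℤ)] [Module (ZMod 3) (V3 W K)] in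
include hb in
/-- **Kummer isotropy of `b_v`** at every place (Poonen–Rains, DISCHARGED in the tree:
`kummerClass_cupProduct_kummerClass_eq_zero_holds`). [cite: PoonenRains2012, Prop. 4.8, Cor. 4.6] -/
theorem invCupProduct_eq_zero_of_mem_kummer (halt : ∀ Q, e Q Q = 1) (v : Place K) :
    ∀ x ∈ (W.baseChange K).kummerLocalConditionAt ((3 ^ 1 : ℕ) : ℤ) (Place.Completion v),
    ∀ y ∈ (W.baseChange K).kummerLocalConditionAt ((3 ^ 1 : ℕ) : ℤ) (Place.Completion v), b v x y = 0 := by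
  intro x hx y hy
  have h3Z : ((3 ^ 1 : ℕ) : ℤ) ≠ 0 := by norm_num
  have h0 : (weilContPairingLocal (W.baseChange K) (3 ^ 1) e hμ hadd₁ hadd₂ hgal v).cupProduct x y = 0 := by
    exact (W.baseChange K).cupProduct_eq_zero_of_mem_kummerSelmerStructure_of_fact (3 ^ 1) e h3Z v
      (kummerClass_cupProduct_kummerClass_eq_zero_holds _) hμ hadd₁ hadd₂ halt hgal hx hy
  rw [hb, h0]
  exact map_zero _

omit [NeZero (W.conductorNorm ℤ)] in
include hb hloc in
/-- **Ordinary isotropy of `b_v` ABOVE A GOOD unipotent-admissible prime** (`h⁰(K_v, E[3]) = 1` there: koly g13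
`natCard_invariants_le_three_of_frobSqNeOneAt`, `weilPairingHom_eq_zero_of_invariant_of_card_le`,
`weilCupProduct_res_eq_zero_of_mem_ordinaryLocalKer`). [cite: BertoliniDarmon2005, §2.2–§2.3] [cite: WZhang2014, Prop. 5.4] -/
theorem invCupProduct_eq_zero_of_mem_ordinary (hK : IsImaginaryQuadratic K) (halt : ∀ Q, e Q Q = 1)
    (q : {q // IsUAdmissiblePrime W K q}) (hq : FrobSqNeOneAt W 3 q.1) (v : HeightOneSpectrum (𝓞 K))
    (hqv : ((q : ℕ) : 𝓞 K) ∈ v.asIdeal) (x y : V3 W K)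
    (hx : x ∈ (W.baseChange K).ordinaryLocalKer (v.adicCompletion K) ((3 ^ 1 : ℕ) : ℤ))
    (hy : y ∈ (W.baseChange K).ordinaryLocalKer (v.adicCompletion K) ((3 ^ 1 : ℕ) : ℤ)) :
    b (Sum.inr v) (loc (Sum.inr v) x) (loc (Sum.inr v) y) = 0 := by
  haveI : Fact (Nat.Prime (3 ^ 1)) := ⟨by norm_num⟩
  have hH0 := Iso.natCard_invariants_le_three_of_frobSqNeOneAt W K hK q hq v hqv
  have h0 : (weilContPairingLocal (W.baseChange K) (3 ^ 1) e hμ hadd₁ hadd₂ hgal (Sum.inr v)).cupProduct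
      (galoisCohomology.localization ((W.baseChange K).torsionGaloisModule ((3 ^ 1 : ℕ) : ℤ)) (Sum.inr v) 1 x)
          (galoisCohomology.localization ((W.baseChange K).torsionGaloisModule ((3 ^ 1 : ℕ) : ℤ)) (Sum.inr v) 1 y)
          = 0 := by
    exact Iso.weilCupProduct_res_eq_zero_of_mem_ordinaryLocalKer (W.baseChange K) (3 ^ 1) (v.adicCompletion K) e
      hμ hadd₁ hadd₂ hgal (Iso.weilPairingHom_eq_zero_of_invariant_of_card_le (W.baseChange K) (3 ^ 1)
        (v.adicCompletion K) e hμ hadd₁ hadd₂ halt hH0) hx hy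
  rw [hb, hloc, hloc, h0]
  exact map_zero _

end Package

/-! ## §2 The triangulation from the Kolyvagin-prime local package + (Supply) -/

/-- **Zhang's Lemma 8.4 triangulation at ONE good non-empty level, from the Kolyvagin-prime local package + (Supply)
only.** See the module docstring. Binders: frame facts `hK`, `hmult`, `hsurj`, `hc`; the level system `S`; the places
`plK` ∕ `plU` of the Kolyvagin ∕ unipotent-admissible primes (`hplK`, `hplU`); the Kolyvagin-prime local package in
cup-product currency, for every Weil-type pairing `e` on `E[3]`: (Tr-iso) `hisoTr`, (Perf) `hperf`; (Line) `hline`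
(in the `galoisCohomology.localization` model, with `ZMod 3`-multiples); the level `n` (good, non-empty, carrying a
non-zero class `hne`); (Supply) `hSupply` for the level-`n` structure. Conclusion: the engine's (A3) shape for `SelQ n` ∕
`SelRelQ n (baseLocusQ S.κ n)`. [cite: WZhang2014, Lemma 8.4 (1)+(3), §8.1] [cite: MilneADT2006, Ch. I, Thm. 4.10] -/
theorem triangulation_of_kolyvaginLocal (hK : IsImaginaryQuadratic K)
    (hmult : W.HasMultiplicativeReductionAtPrime 3) (hsurj : W.HasSurjectiveModNGaloisRep 3) (hc : c ≠ 1)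
    (S : LevelKolyvaginSystem W K Dt β ι c)
    -- the places of the Kolyvagin ∕ unipotent-admissible primes
    (plK : {ℓ // Zhang2014.IsKolyvaginPrime (W.conductorNorm ℤ) W K 3 ℓ} → HeightOneSpectrum (𝓞 K))
    (plU : {q // IsUAdmissiblePrime W K q} → HeightOneSpectrum (𝓞 K))
    (hplK : ∀ ℓ, ((ℓ : ℕ) : 𝓞 K) ∈ (plK ℓ).asIdeal) (hplU : ∀ q, ((q : ℕ) : 𝓞 K) ∈ (plU q).asIdeal)
    -- (Tr-iso): the transverse condition is isotropic for the local Weil cup product, for every Weil-type pairing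
    (hisoTr : ∀ (e : geomTorsion (W.baseChange K) ((3 ^ 1 : ℕ) : ℤ) → geomTorsion (W.baseChange K) ((3 ^ 1 : ℕ) : ℤ) →
        AlgebraicClosure K)
      (hμ : ∀ P Q, e P Q ^ (3 ^ 1) = 1) (hadd₁ : ∀ P₁ P₂ Q, e (P₁ + P₂) Q = e P₁ Q * e P₂ Q)
      (hadd₂ : ∀ P Q₁ Q₂, e P (Q₁ + Q₂) = e P Q₁ * e P Q₂)
      (hgal : ∀ (σ : absoluteGaloisGroup K) (P Q : geomTorsion (W.baseChange K) ((3 ^ 1 : ℕ) : ℤ)),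
        σ • e P Q = e (σ • P) (σ • Q))
      (ℓ : {ℓ // Zhang2014.IsKolyvaginPrime (W.conductorNorm ℤ) W K 3 ℓ}) (x y : V3 W K),
      x ∈ transverseLocalKer W K ι ℓ (plK ℓ) → y ∈ transverseLocalKer W K ι ℓ (plK ℓ) →
      (weilContPairingLocal (W.baseChange K) (3 ^ 1) e hμ hadd₁ hadd₂ hgal (Sum.inr (plK ℓ))).cupProduct
        (galoisCohomology.localization ((W.baseChange K).torsionGaloisModule ((3 ^ 1 : ℕ) : ℤ)) (Sum.inr (plK ℓ)) 1
          x)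
        (galoisCohomology.localization ((W.baseChange K).torsionGaloisModule ((3 ^ 1 : ℕ) : ℤ)) (Sum.inr (plK ℓ)) 1
          y) = 0)
    -- (Perf): Kummer^s × transverse^s is non-degenerate at Kolyvagin primes, for every Weil pairing
    (hperf : ∀ (e : geomTorsion (W.baseChange K) ((3 ^ 1 : ℕ) : ℤ) → geomTorsion (W.baseChange K) ((3 ^ 1 : ℕ) : ℤ) →
        AlgebraicClosure K)
      (hμ : ∀ P Q, e P Q ^ (3 ^ 1) = 1) (hadd₁ : ∀ P₁ P₂ Q, e (P₁ + P₂) Q = e P₁ Q * e P₂ Q)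
      (hadd₂ : ∀ P Q₁ Q₂, e P (Q₁ + Q₂) = e P Q₁ * e P Q₂) (_halt : ∀ Q, e Q Q = 1)
      (_hnondeg : ∀ Q, (∀ P, e P Q = 1) → Q = 0)
      (hgal : ∀ (σ : absoluteGaloisGroup K) (P Q : geomTorsion (W.baseChange K) ((3 ^ 1 : ℕ) : ℤ)),
        σ • e P Q = e (σ • P) (σ • Q))
      (ℓ : {ℓ // Zhang2014.IsKolyvaginPrime (W.conductorNorm ℤ) W K 3 ℓ}) (s : Bool) (x y : V3 W K),
      conjAct W c ((3 ^ 1 : ℕ) : ℤ) x = sgn s • x → conjAct W c ((3 ^ 1 : ℕ) : ℤ) y = sgn s • y →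
      x ∈ selmerLocalKer (W.baseChange K) ((plK ℓ).adicCompletion K) ((3 ^ 1 : ℕ) : ℤ) →
      x ∉ (W.baseChange K).torsionLocalKer ((plK ℓ).adicCompletion K) ((3 ^ 1 : ℕ) : ℤ) →
      y ∈ transverseLocalKer W K ι ℓ (plK ℓ) →
      y ∉ (W.baseChange K).torsionLocalKer ((plK ℓ).adicCompletion K) ((3 ^ 1 : ℕ) : ℤ) →
      (weilContPairingLocal (W.baseChange K) (3 ^ 1) e hμ hadd₁ hadd₂ hgal (Sum.inr (plK ℓ))).cupProduct
        (galoisCohomology.localization ((W.baseChange K).torsionGaloisModule ((3 ^ 1 : ℕ) : ℤ)) (Sum.inr (plK ℓ)) 1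
          x)
        (galoisCohomology.localization ((W.baseChange K).torsionGaloisModule ((3 ^ 1 : ℕ) : ℤ)) (Sum.inr (plK ℓ)) 1
          y) ≠ 0)
    -- (Line): the Kummer eigen-line at a Kolyvagin prime
    (hline : ∀ (ℓ : {ℓ // Zhang2014.IsKolyvaginPrime (W.conductorNorm ℤ) W K 3 ℓ}) (s : Bool),
      ∃ e : galoisCohomology (((W.baseChange K).torsionGaloisModule ((3 ^ 1 : ℕ) : ℤ)).toLocal (Sum.inr (plK ℓ))) 1,
      ∀ x : V3 W K, conjAct W c ((3 ^ 1 : ℕ) : ℤ) x = sgn s • x →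
        x ∈ selmerLocalKer (W.baseChange K) ((plK ℓ).adicCompletion K) ((3 ^ 1 : ℕ) : ℤ) →
        ∃ a : ℤ, galoisCohomology.localization ((W.baseChange K).torsionGaloisModule ((3 ^ 1 : ℕ) : ℤ))
          (Sum.inr (plK ℓ)) 1 x = a • e)
    -- the level: good, non-empty, carrying a non-zero class
    (n : Finset {q // IsUAdmissiblePrime W K q}) (hg : GoodLevel W K n) (hn : n.Nonempty)
    (hne : ∃ m, S.κ m n ≠ 0)
    -- (Supply): Zhang's Lemma 8.2 for the level-n structure
    (hSupply : ∀ (ℓ : {ℓ // Zhang2014.IsKolyvaginPrime (W.conductorNorm ℤ) W K 3 ℓ}) (T : Finset _), ℓ ∉ T →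
      ∀ s : Bool, ∃ x : V3 W K, conjAct W c ((3 ^ 1 : ℕ) : ℤ) x = sgn s • x ∧ x ≠ 0 ∧
        (∀ w : InfinitePlace K, x ∈ selmerLocalKer (W.baseChange K) w.Completion ((3 ^ 1 : ℕ) : ℤ)) ∧
        (∀ v : HeightOneSpectrum (𝓞 K), v ≠ plK ℓ → (∀ ℓ' ∈ T, plK ℓ' ≠ v) →
          ((∀ q ∈ n, ((q : ℕ) : 𝓞 K) ∉ v.asIdeal) →
            x ∈ selmerLocalKer (W.baseChange K) (v.adicCompletion K) ((3 ^ 1 : ℕ) : ℤ)) ∧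
          (∀ q ∈ n, ((q : ℕ) : 𝓞 K) ∈ v.asIdeal →
            x ∈ (W.baseChange K).ordinaryLocalKer (v.adicCompletion K) ((3 ^ 1 : ℕ) : ℤ))) ∧
        (∀ ℓ' ∈ T, x ∈ transverseLocalKer W K ι ℓ' (plK ℓ'))) :
    ∃ (s : Bool) (d : ℕ), finrank (ZMod 3) (SelQ W K c n s) = d + 1 ∧
      SelQ W K c n s = SelRelQ W K c n (baseLocusQ W K S.κ n) s ∧
      FiniteDimensional (ZMod 3) (SelRelQ W K c n (baseLocusQ W K S.κ n) (!s)) ∧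
      finrank (ZMod 3) (SelRelQ W K c n (baseLocusQ W K S.κ n) (!s)) ≤ d := by
  haveI : IsTotallyComplex K := hK.2
  haveI : Fact (Nat.Prime (3 ^ 1)) := ⟨by norm_num⟩
  haveI : NeZero (3 ^ 1 : ℕ) := ⟨by norm_num⟩
  haveI : PerfectField K := PerfectField.ofCharZero
  -- the `ZMod 3`-structure of the local cohomology groups (`3 · H¹(K_v, E[3]) = 0`)
  have hV3 : ∀ (v : Place K) (x : galoisCohomology (((W.baseChange K).torsionGaloisModule ((3 ^ 1 : ℕ) :
      ℤ)).toLocal v) 1), 3 • x = 0 := fun v x ↦ by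
    have h := galoisCohomology.nsmul_eq_zero_of_forall (((W.baseChange K).torsionGaloisModule ((3 ^ 1 : ℕ) :
        ℤ)).toLocal v) (n := 3 ^ 1)
      (fun m => AddSubgroup.torsionBy.nsmul m) x
    exact h
  letI : ∀ v : Place K, Module (ZMod 3) (galoisCohomology (((W.baseChange K).torsionGaloisModule ((3 ^ 1 : ℕ) :
      ℤ)).toLocal v) 1) := fun v ↦
    AddCommGroup.zmodModule (hV3 v)
  -- the localisations, a Weil pairing, the Poitou–Tate family, the local forms
  obtain ⟨loc, hloc⟩ := exists_zmodLinear_localization W K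
  obtain ⟨e, hμ, hadd₁, hadd₂, halt, hnondeg, hgal⟩ :=
    exists_weilPairing_holds (W.baseChange K) (3 ^ 1) (by norm_num) (by norm_num)
  obtain ⟨inv, hinvperf, hPT⟩ := poitouTate_sum_localTatePairing_eq_zero_of_isTotallyComplex K (3 ^ 1)
  obtain ⟨b, hb⟩ := exists_zmodBilinear_invCupProduct W K e hμ hadd₁ hadd₂ hgal inv
  -- (REC), Kummer isotropy, ordinary isotropy above good unipotent-admissible primes
  have hrec : ∀ (x y : V3 W K) (T : Finset (Place K)), (∀ v, v ∉ T → b v (loc v x) (loc v y) = 0) →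
      ∑ v ∈ T, b v (loc v x) (loc v y) = 0 := fun x y T hT ↦ sum_invCupProduct_eq_zero W K hb hloc hPT x y T hT
  have hisoKum := fun v ↦ invCupProduct_eq_zero_of_mem_kummer W K hb halt v
  have hisoOrd : ∀ (q : {q // IsUAdmissiblePrime W K q}), FrobSqNeOneAt W 3 q.1 →
      ∀ (v : HeightOneSpectrum (𝓞 K)), ((q : ℕ) : 𝓞 K) ∈ v.asIdeal → ∀ (x y : V3 W K),
      x ∈ (W.baseChange K).ordinaryLocalKer (v.adicCompletion K) ((3 ^ 1 : ℕ) : ℤ) →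
      y ∈ (W.baseChange K).ordinaryLocalKer (v.adicCompletion K) ((3 ^ 1 : ℕ) : ℤ) →
      b (Sum.inr v) (loc (Sum.inr v) x) (loc (Sum.inr v) y) = 0 :=
    fun q hq v hqv x y hx hy ↦ invCupProduct_eq_zero_of_mem_ordinary W K hb hloc hK halt q hq v hqv x y hx hy
  -- the Kolyvagin-prime local package in `b`-currency (`inv_λ` is injective)
  have hinj : ∀ v : HeightOneSpectrum (𝓞 K), Function.Injective (inv (Sum.inr v)) := fun v ↦ (hinvperf v).1.1
  have hisoTr' : ∀ (ℓ : {ℓ // Zhang2014.IsKolyvaginPrime (W.conductorNorm ℤ) W K 3 ℓ}) (x y : V3 W K),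
      x ∈ transverseLocalKer W K ι ℓ (plK ℓ) → y ∈ transverseLocalKer W K ι ℓ (plK ℓ) →
      b (Sum.inr (plK ℓ)) (loc (Sum.inr (plK ℓ)) x) (loc (Sum.inr (plK ℓ)) y) = 0 := by
    intro ℓ x y hx hy
    rw [hb, hloc, hloc, hisoTr e hμ hadd₁ hadd₂ hgal ℓ x y hx hy]
    exact map_zero _
  have hperf' : ∀ (ℓ : {ℓ // Zhang2014.IsKolyvaginPrime (W.conductorNorm ℤ) W K 3 ℓ}) (s : Bool) (x y : V3 W K),
      conjAct W c ((3 ^ 1 : ℕ) : ℤ) x = sgn s • x → conjAct W c ((3 ^ 1 : ℕ) : ℤ) y = sgn s • y →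
      x ∈ selmerLocalKer (W.baseChange K) ((plK ℓ).adicCompletion K) ((3 ^ 1 : ℕ) : ℤ) →
      x ∉ (W.baseChange K).torsionLocalKer ((plK ℓ).adicCompletion K) ((3 ^ 1 : ℕ) : ℤ) →
      y ∈ transverseLocalKer W K ι ℓ (plK ℓ) →
      y ∉ (W.baseChange K).torsionLocalKer ((plK ℓ).adicCompletion K) ((3 ^ 1 : ℕ) : ℤ) →
      b (Sum.inr (plK ℓ)) (loc (Sum.inr (plK ℓ)) x) (loc (Sum.inr (plK ℓ)) y) ≠ 0 := by
    intro ℓ s x y hxs hys hxK hx0 hyT hy0 h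
    rw [hb, hloc, hloc] at h
    exact hperf e hμ hadd₁ hadd₂ halt hnondeg hgal ℓ s x y hxs hys hxK hx0 hyT hy0
      (hinj _ (h.trans (map_zero _).symm))
  have hline' : ∀ (ℓ : {ℓ // Zhang2014.IsKolyvaginPrime (W.conductorNorm ℤ) W K 3 ℓ}) (s : Bool),
      ∃ e' : galoisCohomology (((W.baseChange K).torsionGaloisModule ((3 ^ 1 : ℕ) : ℤ)).toLocal (Sum.inr (plK ℓ))) 1,
      ∀ x : V3 W K, conjAct W c ((3 ^ 1 : ℕ) : ℤ) x = sgn s • x →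
        x ∈ selmerLocalKer (W.baseChange K) ((plK ℓ).adicCompletion K) ((3 ^ 1 : ℕ) : ℤ) →
        ∃ a : ZMod 3, loc (Sum.inr (plK ℓ)) x = a • e' := by
    intro ℓ s
    obtain ⟨e', he'⟩ := hline ℓ s
    refine ⟨e', fun x hxs hxK ↦ ?_⟩
    obtain ⟨a, ha⟩ := he' x hxs hxK
    refine ⟨(a : ZMod 3), ?_⟩
    rw [hloc, ha, Int.cast_smul_eq_zsmul]
  exact triangulation_of_localGlobal W K Dt β ι c hK hmult hsurj hc S loc hloc plK plU hplK hplU b hrec hisoKum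
    hisoOrd hisoTr' hperf' hline' n hg hn hne hSupply

end Summit.BirchSwinnertonDyer.Rank1Residual.X11b.Three.Koly.Method2

end
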